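import Summits.BirchSwinnertonDyer.BirchSwinnertonDyer.Theses.SignedLowerHalves
import Summits.BirchSwinnertonDyer.Rank1Residual.Supersingular.KobayashiMainConjectureKuriharaRigidity
import Literature.NumberTheory.EllipticCurves.Rank1Residual.Typed.X7
import HarnessLib

/-!
# Crux `KobayashiLowerHalfLargeImage` (route `SignedLowerHalves`, item stmt-BirchSwinnertonDyer-19001), line
# `kurihara_rigidity` (reshape r2): the crux BY NAME MODULO the line's named inputs — Kim AJM 2026 Thm 1.11 ∘
# Kobayashi 2003 Thm 7.4 (`Kim2026_thm111_via_kobayashi74`, PUBLISHED), Castella–Sano 2026 Thm 1 ∘ Kobayashi 7.4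
# (`CastellaSano2026_thm1_via_kobayashi74_OPEN`, PREPRINT), the period transfer (`realPeriodRat_eq_unit_mul_plusPeriod`,
# PUBLISHED) — and the line's two OPEN stubs = the halves of Kim's Conjecture 1.10 on the large-image corner of X7,
# plus the `p = 3` residue (cell `bsd-ssimc`, seat `bsd-line-slh-p1`, lead of the line)

HONEST FRAMING (D-0152): theorems only; every theorem is CONDITIONAL on displayed hypotheses (two of them named
facts of published theorems, one an unrefereed-preprint binder, three the line's open stubs); nothing is closed or
booked; BSD is not proved by any of this. This file composes the landed halves of the line:
`Rank1Residual/Supersingular/KobayashiMainConjectureKuriharaRigidity.lean` (p606756: the binders and the two ENGINE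
stubs closed modulo them) and `Theorems/SignedLowerHalvesKobayashiLowerHalfLargeImageKuriharaRigidity.lean`
(p607027: the composition BY NAME against ENGINE statements and `X4.KimTamagawaDefectLeAt/GeAt`). Results:

* `kobayashiLowerHalfLargeImage_of_kim111_of_castellaSano_OPEN` — THE LINE IN ONE THEOREM: crux 3 BY NAME from
  `Kim2026_thm111_via_kobayashi74`, `CastellaSano2026_thm1_via_kobayashi74_OPEN`, `realPeriodRat_eq_unit_mul_plusPeriod`
  and the three open stub STATEMENTS (`≤` half, `≥` half, `p = 3`). So the trust base of the crux along this line
  reads: two published theorems + one preprint + Kim's Conjecture 1.10 on X7 ∧ ¬CM ∧ Surj ∧ `p ≥ 5` + the `p = 3` case.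
* `X7.kobayashiMainConjecture_of_kim111_of_kimTamagawaDefectLe` / `X7.kobayashiLowerDivisibility_of_kim111_…` —
  on the rows `p ∤ ∏ c_ℓ` (734 of the 995 surjective analytic-rank-one window pairs at `p ≥ 5`, DOSSIER-19001 §3, and
  class-wide) the preprint and the `≥` half drop out: BOTH signed main conjectures, hence the crux's conclusion,
  from PUBLISHED facts + the `≤` half alone (= Kurihara's conjecture `X4.KuriharaUnitAt`: ONE unit Kurihara number
  at ONE cyclic Kolyvagin level, per pair decidable).

References: [Kim2022StructureSelmer] Thm 1.11, Conj 1.10; [CastellaSano2026] Thm 1 (PRE); [Kobayashi2003] Thm 7.4,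
Conjecture (p. 2); [GreenbergVatsal2000] §3 Rem 3.4; [Mazur1978] Cor 4.1.
-/

set_option autoImplicit false
-- the Theorems namespace of a single-conjunct summit repeats the summit name by design (D-0017)
set_option linter.dupNamespace false

noncomputable section

open scoped Classical MatrixGroups ModularForm

open CongruenceSubgroup WeierstrassCurve Literature.NumberTheory.EllipticCurves
  Literature.NumberTheory.EllipticCurves.ModularForms
  Literature.NumberTheory.EllipticCurves.Rank1Residual
  Literature.NumberTheory.EllipticCurves.Rank1Residual.Typed
  Summit.BirchSwinnertonDyer.Rank1Residual.Supersingular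
  Summit.BirchSwinnertonDyer.Rank1Residual.X4

namespace Summit.BirchSwinnertonDyer.BirchSwinnertonDyer.Theorems.KuriharaRigidity

variable (W : WeierstrassCurve ℚ) [W.IsElliptic] [W.IsGloballyMinimal] (p : ℕ) [Fact p.Prime]

/-- **Rows `p ∤ ∏ c_ℓ` of the large-image corner of X7: BOTH signed main conjectures from PUBLISHED facts and
the `≤` half alone.** GRANTED `Kim2026_thm111_via_kobayashi74` (`hKK`) and the period fact (`h5`): at an X7 pair
with `p ≥ 5`, `a_p = 0`, `ρ̄` onto and `p ∤ ∏ c_ℓ`, the `≤` half `X4.KimTamagawaDefectLeAt W p f` for the newforms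
of `W` (there: a unit Kurihara number at a cyclic level) gives `KobayashiMainConjecture W p ε` for every sign `ε`.
No preprint, no `≥` half, no `¬CM`. CONDITIONAL; closes nothing.
[cite: Kim2022StructureSelmer, Thm. 1.11 (1) ⟹ (3) and Conj. 1.10] [cite: Kobayashi2003, Thm. 7.4 (p. 13)] -/
theorem X7.kobayashiMainConjecture_of_kim111_of_kimTamagawaDefectLe (hKK : Kim2026_thm111_via_kobayashi74)
    (h5 : realPeriodRat_eq_unit_mul_plusPeriod) (hp5 : 5 ≤ p) (hX : ClassX7 W p)
    (hap : W.frobeniusTrace p = 0) (hs : Surj W p) (htam : ¬ p ∣ W.tamagawaProduct)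
    (hLe : ∀ [NeZero (W.conductorNorm ℤ)] (f : CuspForm (Gamma0 (W.conductorNorm ℤ)) 2),
      IsNewformOf W f → KimTamagawaDefectLeAt W p f) (ε : ℤˣ) :
    KobayashiMainConjecture W p ε := by
  refine Summit.BirchSwinnertonDyer.Rank1Residual.Supersingular.KuriharaRigidity.signedMC_of_kuriharaPartialInfty_eq_zero
    hKK h5 W p hp5 hX.1.1 hap hs htam (fun f hf => ?_) ε
  have h := hLe f hf
  rw [KimTamagawaDefectLeAt, padicValNat.eq_zero_of_not_dvd htam, Nat.cast_zero] at h
  exact nonpos_iff_eq_zero.mp h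

/-- **… hence the crux's conclusion at such a pair from PUBLISHED facts + the `≤` half** (the Eisenstein half of
Kobayashi's main conjecture for the sign `+1`). CONDITIONAL; closes nothing.
[cite: Kim2022StructureSelmer, Thm. 1.11 (1) ⟹ (3) and Conj. 1.10] [cite: Kobayashi2003, Thm. 7.4 (p. 13) and Conjecture (p. 2)] -/
theorem X7.kobayashiLowerDivisibility_of_kim111_of_kimTamagawaDefectLe (hKK : Kim2026_thm111_via_kobayashi74)
    (h5 : realPeriodRat_eq_unit_mul_plusPeriod) (hp5 : 5 ≤ p) (hX : ClassX7 W p)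
    (hap : W.frobeniusTrace p = 0) (hs : Surj W p) (htam : ¬ p ∣ W.tamagawaProduct)
    (hLe : ∀ [NeZero (W.conductorNorm ℤ)] (f : CuspForm (Gamma0 (W.conductorNorm ℤ)) 2),
      IsNewformOf W f → KimTamagawaDefectLeAt W p f) :
    ∃ ε : ℤˣ, KobayashiLowerDivisibility W p ε :=
  ⟨1, kobayashiLowerDivisibility_of_mainConjecture
    (X7.kobayashiMainConjecture_of_kim111_of_kimTamagawaDefectLe W p hKK h5 hp5 hX hap hs htam hLe 1)⟩

/-- **General rows: BOTH signed main conjectures at an X7 ∧ ¬CM ∧ Surj pair at `p ≥ 5` from Kim's Conjecture 1.10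
at the pair** (`X4.KimTamagawaDefectAt W p f` for the newforms of `W`), GRANTED the OPEN binder
`CastellaSano2026_thm1_via_kobayashi74_OPEN` (`hCS`) and the period fact (`h5`). CONDITIONAL; closes nothing.
[claim: CastellaSano2026, status: under-review] [cite: Kobayashi2003, Thm. 7.4 (p. 13)] -/
theorem X7.kobayashiMainConjecture_of_castellaSano_OPEN_of_kimTamagawaDefect
    (hCS : CastellaSano2026_thm1_via_kobayashi74_OPEN) (h5 : realPeriodRat_eq_unit_mul_plusPeriod)
    (hp5 : 5 ≤ p) (hX : ClassX7 W p) (hcm : ¬ W.HasCM) (hap : W.frobeniusTrace p = 0) (hs : Surj W p)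
    (hKim : ∀ [NeZero (W.conductorNorm ℤ)] (f : CuspForm (Gamma0 (W.conductorNorm ℤ)) 2),
      IsNewformOf W f → KimTamagawaDefectAt W p f) (ε : ℤˣ) :
    KobayashiMainConjecture W p ε :=
  Summit.BirchSwinnertonDyer.Rank1Residual.Supersingular.KuriharaRigidity.signedMC_of_kimTamagawaDefect hCS h5 W p hp5 hX.1.1 hap hcm hs
    (fun f hf => hKim f hf) ε

/-- **THE LINE `kurihara_rigidity` IN ONE THEOREM.** The crux `KobayashiLowerHalfLargeImage` BY NAME follows from:
the named fact `Kim2026_thm111_via_kobayashi74` (`hKK`; Kim AJM 2026 Thm 1.11 (1)⇒(3) ∘ Kobayashi 2003 Thm 7.4,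
PUBLISHED), the OPEN binder `CastellaSano2026_thm1_via_kobayashi74_OPEN` (`hCS`; Castella–Sano Thm 1 (i)⇒(ii) ∘
Kobayashi 7.4, the first half an unrefereed PREPRINT), the period fact `realPeriodRat_eq_unit_mul_plusPeriod`
(`h5`; Greenberg–Vatsal / Mazur, PUBLISHED), and the line's three OPEN stub statements: the `≤` half (`hLe`) and
the `≥` half (`hGe`) of Kim's Conjecture 1.10 for the newform of every X7 ∧ ¬CM ∧ `a_p = 0` ∧ Surj pair at
`p ≥ 5`, and the crux's own conclusion at `p = 3` (`h3`). CONDITIONAL; closes nothing.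
[cite: Kim2022StructureSelmer, Thm. 1.11 (1) ⟹ (3) and Conj. 1.10 (PDF p. 8)]
[cite: Kobayashi2003, Thm. 7.4 (p. 13) and Conjecture (p. 2)] [claim: CastellaSano2026, status: under-review]
[cite: GreenbergVatsal2000, §3, Remark 3.4] -/
theorem kobayashiLowerHalfLargeImage_of_kim111_of_castellaSano_OPEN
    (hKK : Kim2026_thm111_via_kobayashi74) (hCS : CastellaSano2026_thm1_via_kobayashi74_OPEN)
    (h5 : realPeriodRat_eq_unit_mul_plusPeriod)
    (hLe : ∀ (W : WeierstrassCurve ℚ) [W.IsElliptic] [W.IsGloballyMinimal] (p : ℕ) [Fact p.Prime],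
      5 ≤ p → ClassX7 W p → ¬ W.HasCM → W.frobeniusTrace p = 0 → Surj W p →
      ∀ [NeZero (W.conductorNorm ℤ)] (f : CuspForm (Gamma0 (W.conductorNorm ℤ)) 2),
        IsNewformOf W f → KimTamagawaDefectLeAt W p f)
    (hGe : ∀ (W : WeierstrassCurve ℚ) [W.IsElliptic] [W.IsGloballyMinimal] (p : ℕ) [Fact p.Prime],
      5 ≤ p → ClassX7 W p → ¬ W.HasCM → W.frobeniusTrace p = 0 → Surj W p →
      ∀ [NeZero (W.conductorNorm ℤ)] (f : CuspForm (Gamma0 (W.conductorNorm ℤ)) 2),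
        IsNewformOf W f → KimTamagawaDefectGeAt W p f)
    (h3 : ∀ (W : WeierstrassCurve ℚ) [W.IsElliptic] [W.IsGloballyMinimal] (p : ℕ) [Fact p.Prime],
      p = 3 → ClassX7 W p → ¬ W.HasCM → W.frobeniusTrace p = 0 → Surj W p →
      ∃ ε : ℤˣ, KobayashiLowerDivisibility W p ε) :
    Summit.BirchSwinnertonDyer.BirchSwinnertonDyer.Theses.SignedLowerHalves.KobayashiLowerHalfLargeImage := by
  intro W _ _ p _ hp2 hX hcm hap hs
  have hpP : p.Prime := Fact.out
  by_cases hp5 : 5 ≤ p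
  · by_cases htam : p ∣ W.tamagawaProduct
    · exact ⟨1, kobayashiLowerDivisibility_of_mainConjecture
        (Summit.BirchSwinnertonDyer.Rank1Residual.Supersingular.KuriharaRigidity.signedMC_of_kimTamagawaDefect
          hCS h5 W p hp5 hX.1.1 hap hcm hs (fun f hf => (kimTamagawaDefectAt_iff W p f).mpr
            ⟨hLe W p hp5 hX hcm hap hs f hf, hGe W p hp5 hX hcm hap hs f hf⟩) 1)⟩
    · exact X7.kobayashiLowerDivisibility_of_kim111_of_kimTamagawaDefectLe W p hKK h5 hp5 hX hap hs htam
        (fun f hf => hLe W p hp5 hX hcm hap hs f hf)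
  · have hp3 : p = 3 := by
      have h2 := hpP.two_le
      interval_cases p
      · exact absurd rfl hp2
      · rfl
      · exact absurd hpP (by decide)
    exact h3 W p hp3 hX hcm hap hs

/-! ### Appended (lead cycle 1, after p607714): with the `≥` half read from Castella–Sano §2, the line's open
content at `p ≥ 5` is ONE stub — the `≤` half of Kim's Conjecture 1.10 on the large-image corner of X7 -/

/-- **THE LINE `kurihara_rigidity` IN ONE THEOREM, `≥` half discharged modulo its reading.** The crux
`KobayashiLowerHalfLargeImage` BY NAME follows from: `Kim2026_thm111_via_kobayashi74` (`hKK`; PUBLISHED ×2),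
`CastellaSano2026_thm1_via_kobayashi74_OPEN` (`hCS`; PREPRINT ∘ PUBLISHED), the reading
`CastellaSano2026_sec2_tamagawaDefectGe_implicit_OPEN` (`hCSge`; PREPRINT, implicit in §2), the period fact
`realPeriodRat_eq_unit_mul_plusPeriod` (`h5`; PUBLISHED), and TWO open statements only: the `≤` half
`X4.KimTamagawaDefectLeAt W p f` for the newform of every X7 ∧ ¬CM ∧ `a_p = 0` ∧ Surj pair at `p ≥ 5` (`hLe` — ONE
non-vanishing Kurihara number per pair, `kimTamagawaDefectLeAt_iff_exists_certificate`) and the crux's own conclusion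
at `p = 3` (`h3`). CONDITIONAL; closes nothing; BSD is not proved by any of this.
[cite: Kim2022StructureSelmer, Thm. 1.11 (1) ⟹ (3) and Conj. 1.10 (PDF p. 8)]
[cite: Kobayashi2003, Thm. 7.4 (p. 13) and Conjecture (p. 2)] [claim: CastellaSano2026, status: under-review]
[cite: GreenbergVatsal2000, §3, Remark 3.4] -/
theorem kobayashiLowerHalfLargeImage_of_kim111_of_castellaSano_readings_OPEN
    (hKK : Kim2026_thm111_via_kobayashi74) (hCS : CastellaSano2026_thm1_via_kobayashi74_OPEN)
    (hCSge : CastellaSano2026_sec2_tamagawaDefectGe_implicit_OPEN) (h5 : realPeriodRat_eq_unit_mul_plusPeriod)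
    (hLe : ∀ (W : WeierstrassCurve ℚ) [W.IsElliptic] [W.IsGloballyMinimal] (p : ℕ) [Fact p.Prime],
      5 ≤ p → ClassX7 W p → ¬ W.HasCM → W.frobeniusTrace p = 0 → Surj W p →
      ∀ [NeZero (W.conductorNorm ℤ)] (f : CuspForm (Gamma0 (W.conductorNorm ℤ)) 2),
        IsNewformOf W f → KimTamagawaDefectLeAt W p f)
    (h3 : ∀ (W : WeierstrassCurve ℚ) [W.IsElliptic] [W.IsGloballyMinimal] (p : ℕ) [Fact p.Prime],
      p = 3 → ClassX7 W p → ¬ W.HasCM → W.frobeniusTrace p = 0 → Surj W p →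
      ∃ ε : ℤˣ, KobayashiLowerDivisibility W p ε) :
    Summit.BirchSwinnertonDyer.BirchSwinnertonDyer.Theses.SignedLowerHalves.KobayashiLowerHalfLargeImage :=
  kobayashiLowerHalfLargeImage_of_kim111_of_castellaSano_OPEN hKK hCS h5 hLe
    (Summit.BirchSwinnertonDyer.Rank1Residual.Supersingular.KuriharaRigidity.tamagawa_le_kuriharaPartialInfty_X7
      hCSge h5) h3

/-- **At a single X7 pair (`p ≥ 5`, non-CM, `a_p = 0`, `ρ̄` onto): the crux's conclusion — indeed BOTH signed main
conjectures — from the `≤` half alone**, GRANTED the two Castella–Sano readings (`hCS`, `hCSge`) and the period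
fact (`h5`). On the `p ∤ ∏ c_ℓ` rows the published binder suffices instead
(`X7.kobayashiMainConjecture_of_kim111_of_kimTamagawaDefectLe`). CONDITIONAL; closes nothing.
[claim: CastellaSano2026, status: under-review] [cite: Kobayashi2003, Thm. 7.4 (p. 13)] -/
theorem X7.kobayashiMainConjecture_of_castellaSano_readings_of_kimTamagawaDefectLe
    (hCS : CastellaSano2026_thm1_via_kobayashi74_OPEN)
    (hCSge : CastellaSano2026_sec2_tamagawaDefectGe_implicit_OPEN) (h5 : realPeriodRat_eq_unit_mul_plusPeriod)
    (hp5 : 5 ≤ p) (hX : ClassX7 W p) (hcm : ¬ W.HasCM) (hap : W.frobeniusTrace p = 0) (hs : Surj W p)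
    {N : ℕ} [NeZero N] (f : CuspForm (Gamma0 N) 2) (hf : IsNewformOf W f) (hLe : KimTamagawaDefectLeAt W p f)
    (ε : ℤˣ) : KobayashiMainConjecture W p ε :=
  Summit.BirchSwinnertonDyer.Rank1Residual.Supersingular.KuriharaRigidity.signedMC_of_kimTamagawaDefectLe hCS
    hCSge h5 W p hp5 hX.1.1 hap hcm hs f hf hLe ε

end Summit.BirchSwinnertonDyer.BirchSwinnertonDyer.Theorems.KuriharaRigidity

end
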